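import Mathlib
import HarnessLib

/-!
# Stub `stub_binomial` (crux stmt-CriticalPhenomena-5476 `UniformBoxCrossing`, line `Sketch`,
# v4 microcanonical composition): binomial mixtures of monotone profiles

Pure finite mathematics used by the glue of the v4 skeleton (tilt identity + binomial mixture +
locality + microcanonical monotonicity). For `F : ℕ`, a sequence `N : ℕ → ℝ` and `s ∈ [0, 1]`
put `f(s) = Σ_{k ≤ F} s^k (1-s)^{F-k} N_k`; with `φ̄_k = N_k / C(F,k)` this is the
`Bin(F, s)`-expectation of `φ̄` (the `C(F,k) s^k (1-s)^{F-k}` are the binomial weights).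

* (i) `le_binomialMixture`: if `φ̄` is non-decreasing on `0…F` (cross-multiplied:
  `N_k C(F,k+1) ≤ N_{k+1} C(F,k)` for `k + 1 ≤ F`), then `N_0 ≤ f(s)`. Chaining the hypothesis
  gives `N_0 C(F,k) ≤ N_k` for `k ≤ F`, and `Σ_k C(F,k) s^k (1-s)^{F-k} = (s + (1-s))^F = 1`
  (`add_pow`).
* (ii) `binomialMixture_antitoneOn`: if `φ̄` is non-increasing (`N_{k+1} C(F,k) ≤ N_k C(F,k+1)`),
  then `f` is antitone on `[0, 1]`: `f` is a polynomial with
  `f'(s) = Σ_{j < F} s^j (1-s)^{F-1-j} ((j+1) N_{j+1} - (F-j) N_j)`, the hypothesis is equivalent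
  to `(j+1) N_{j+1} ≤ (F-j) N_j` because `C(F,j+1) (j+1) = C(F,j) (F-j)`
  (`Nat.choose_succ_right_eq`), so `f' ≤ 0` on `[0, 1]` and `antitoneOn_of_deriv_nonpos` applies.

The sign hypothesis `0 ≤ N_k` of the registered signature is not needed for either part.
-/

namespace Summit.CriticalPhenomena.CardyFormulaZ2.Cruxes.UniformBoxCrossing.Microcanonical

open Finset

/-- Chaining the cross-multiplied monotonicity `N_k C(F,k+1) ≤ N_{k+1} C(F,k)` (`k + 1 ≤ F`) down
to the index `0`: `N_0 C(F,k) ≤ N_k` for every `k ≤ F`. -/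
private lemma choose_mul_le_of_crossMono (F : ℕ) (N : ℕ → ℝ)
    (hmono : ∀ k, k + 1 ≤ F → N k * (F.choose (k + 1) : ℝ) ≤ N (k + 1) * (F.choose k : ℝ)) :
    ∀ k, k ≤ F → N 0 * (F.choose k : ℝ) ≤ N k := by
  intro k
  induction k with
  | zero => intro; simp
  | succ k ih =>
    intro hk
    have hc : (0 : ℝ) < F.choose k := by exact_mod_cast Nat.choose_pos (by omega)
    refine le_of_mul_le_mul_left ?_ hc
    calc (F.choose k : ℝ) * (N 0 * F.choose (k + 1))
        = N 0 * F.choose k * F.choose (k + 1) := by ring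
      _ ≤ N k * F.choose (k + 1) :=
          mul_le_mul_of_nonneg_right (ih (Nat.le_of_succ_le hk)) (Nat.cast_nonneg _)
      _ ≤ N (k + 1) * F.choose k := hmono k hk
      _ = F.choose k * N (k + 1) := by ring

/-- **Part (i).** A binomial mixture `Σ_{k ≤ F} s^k (1-s)^{F-k} N_k`, `s ∈ [0, 1]`, of a profile
`N_k / C(F,k)` that is non-decreasing on `0…F` (in cross-multiplied form) is at least its `k = 0`
value `N_0` (the binomial weights sum to `(s + (1 - s))^F = 1`). -/
private theorem le_binomialMixture (F : ℕ) (N : ℕ → ℝ)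
    (hmono : ∀ k, k + 1 ≤ F → N k * (F.choose (k + 1) : ℝ) ≤ N (k + 1) * (F.choose k : ℝ))
    {s : ℝ} (hs0 : 0 ≤ s) (hs1 : s ≤ 1) :
    N 0 ≤ ∑ k ∈ range (F + 1), s ^ k * (1 - s) ^ (F - k) * N k := by
  have hbinom : ∑ k ∈ range (F + 1), s ^ k * (1 - s) ^ (F - k) * (F.choose k : ℝ) = 1 := by
    have h := add_pow s (1 - s) F
    have h1 : s + (1 - s) = 1 := by ring
    rw [h1, one_pow] at h
    exact h.symm
  have hs1' : 0 ≤ 1 - s := sub_nonneg.2 hs1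
  calc N 0 = ∑ k ∈ range (F + 1), s ^ k * (1 - s) ^ (F - k) * (F.choose k : ℝ) * N 0 := by
        rw [← sum_mul, hbinom, one_mul]
    _ ≤ ∑ k ∈ range (F + 1), s ^ k * (1 - s) ^ (F - k) * N k := by
        refine sum_le_sum fun k hk => ?_
        have hk' : k ≤ F := Nat.le_of_lt_succ (mem_range.1 hk)
        calc s ^ k * (1 - s) ^ (F - k) * (F.choose k : ℝ) * N 0
            = s ^ k * (1 - s) ^ (F - k) * (N 0 * F.choose k) := by ring
          _ ≤ s ^ k * (1 - s) ^ (F - k) * N k :=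
              mul_le_mul_of_nonneg_left (choose_mul_le_of_crossMono F N hmono k hk')
                (by positivity)

/-- The cross-multiplied hypothesis of (ii) in falling-factorial form: for `k + 1 ≤ F`,
`N_{k+1} C(F,k) ≤ N_k C(F,k+1)` gives `(k+1) N_{k+1} ≤ (F-k) N_k`, by
`C(F,k+1) (k+1) = C(F,k) (F-k)` and `C(F,k) > 0`. -/
private lemma succ_mul_le_of_crossAnti (F : ℕ) (N : ℕ → ℝ) (k : ℕ) (hk : k + 1 ≤ F)
    (h : N (k + 1) * (F.choose k : ℝ) ≤ N k * (F.choose (k + 1) : ℝ)) :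
    ((k : ℝ) + 1) * N (k + 1) ≤ ((F - k : ℕ) : ℝ) * N k := by
  have hc : (0 : ℝ) < F.choose k := by exact_mod_cast Nat.choose_pos (by omega)
  have hid : (F.choose (k + 1) : ℝ) * ((k : ℝ) + 1) = (F.choose k : ℝ) * ((F - k : ℕ) : ℝ) := by
    exact_mod_cast Nat.choose_succ_right_eq F k
  refine le_of_mul_le_mul_left ?_ hc
  calc (F.choose k : ℝ) * (((k : ℝ) + 1) * N (k + 1))
      = ((k : ℝ) + 1) * (N (k + 1) * F.choose k) := by ring
    _ ≤ ((k : ℝ) + 1) * (N k * F.choose (k + 1)) := mul_le_mul_of_nonneg_left h (by positivity)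
    _ = N k * (F.choose (k + 1) * ((k : ℝ) + 1)) := by ring
    _ = (F.choose k : ℝ) * (((F - k : ℕ) : ℝ) * N k) := by rw [hid]; ring

/-- The derivative bound of (ii): for `0 ≤ x ≤ 1` the term-wise derivative
`Σ_{k ≤ F} (k x^{k-1} (1-x)^{F-k} - x^k (F-k) (1-x)^{F-k-1}) N_k` of the mixture equals, after
re-indexing the first part, `Σ_{k < F} x^k (1-x)^{F-k-1} ((k+1) N_{k+1} - (F-k) N_k) ≤ 0`. -/
private lemma derivSum_nonpos (F : ℕ) (N : ℕ → ℝ)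
    (hmono : ∀ k, k + 1 ≤ F → ((k : ℝ) + 1) * N (k + 1) ≤ ((F - k : ℕ) : ℝ) * N k)
    {x : ℝ} (hx0 : 0 ≤ x) (hx1 : x ≤ 1) :
    ∑ k ∈ range (F + 1), ((k : ℝ) * x ^ (k - 1) * (1 - x) ^ (F - k)
        + x ^ k * (((F - k : ℕ) : ℝ) * (1 - x) ^ (F - k - 1) * -1)) * N k ≤ 0 := by
  have hL : ∑ k ∈ range (F + 1), (k : ℝ) * x ^ (k - 1) * (1 - x) ^ (F - k) * N k
      = ∑ k ∈ range F, ((k : ℝ) + 1) * x ^ k * (1 - x) ^ (F - k - 1) * N (k + 1) := by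
    rw [sum_range_succ']
    simp only [Nat.cast_zero, zero_mul, add_zero, Nat.add_sub_cancel, Nat.sub_add_eq,
      Nat.cast_add, Nat.cast_one]
  have hR : ∑ k ∈ range (F + 1), ((F - k : ℕ) : ℝ) * x ^ k * (1 - x) ^ (F - k - 1) * N k
      = ∑ k ∈ range F, ((F - k : ℕ) : ℝ) * x ^ k * (1 - x) ^ (F - k - 1) * N k := by
    rw [sum_range_succ]
    simp only [Nat.sub_self, Nat.cast_zero, zero_mul, add_zero]
  have hx1' : 0 ≤ 1 - x := sub_nonneg.2 hx1
  calc ∑ k ∈ range (F + 1), ((k : ℝ) * x ^ (k - 1) * (1 - x) ^ (F - k)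
          + x ^ k * (((F - k : ℕ) : ℝ) * (1 - x) ^ (F - k - 1) * -1)) * N k
      = ∑ k ∈ range (F + 1), (k : ℝ) * x ^ (k - 1) * (1 - x) ^ (F - k) * N k
          - ∑ k ∈ range (F + 1), ((F - k : ℕ) : ℝ) * x ^ k * (1 - x) ^ (F - k - 1) * N k := by
        rw [← sum_sub_distrib]
        exact sum_congr rfl fun k _ => by ring
    _ ≤ 0 := by
        rw [hL, hR, sub_nonpos]
        refine sum_le_sum fun k hk => ?_
        calc ((k : ℝ) + 1) * x ^ k * (1 - x) ^ (F - k - 1) * N (k + 1)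
            = x ^ k * (1 - x) ^ (F - k - 1) * (((k : ℝ) + 1) * N (k + 1)) := by ring
          _ ≤ x ^ k * (1 - x) ^ (F - k - 1) * (((F - k : ℕ) : ℝ) * N k) :=
              mul_le_mul_of_nonneg_left (hmono k (mem_range.1 hk)) (by positivity)
          _ = ((F - k : ℕ) : ℝ) * x ^ k * (1 - x) ^ (F - k - 1) * N k := by ring

/-- **Part (ii).** A binomial mixture `s ↦ Σ_{k ≤ F} s^k (1-s)^{F-k} N_k` of a profile
`N_k / C(F,k)` that is non-increasing on `0…F` (in cross-multiplied form) is antitone on `[0, 1]`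
(stochastic monotonicity of the binomial family; here via the sign of the derivative). -/
private theorem binomialMixture_antitoneOn (F : ℕ) (N : ℕ → ℝ)
    (hmono : ∀ k, k + 1 ≤ F → N (k + 1) * (F.choose k : ℝ) ≤ N k * (F.choose (k + 1) : ℝ)) :
    AntitoneOn (fun s : ℝ => ∑ k ∈ range (F + 1), s ^ k * (1 - s) ^ (F - k) * N k)
      (Set.Icc 0 1) := by
  have hderiv : ∀ x : ℝ, HasDerivAt
      (fun s : ℝ => ∑ k ∈ range (F + 1), s ^ k * (1 - s) ^ (F - k) * N k)
      (∑ k ∈ range (F + 1), ((k : ℝ) * x ^ (k - 1) * (1 - x) ^ (F - k)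
        + x ^ k * (((F - k : ℕ) : ℝ) * (1 - x) ^ (F - k - 1) * -1)) * N k) x := by
    intro x
    refine HasDerivAt.fun_sum fun k _ => ?_
    exact ((hasDerivAt_pow k x).fun_mul
      (((hasDerivAt_id' x).const_sub 1).fun_pow (F - k))).mul_const (N k)
  refine antitoneOn_of_deriv_nonpos (convex_Icc 0 1)
    (fun x _ => (hderiv x).continuousAt.continuousWithinAt)
    (fun x _ => (hderiv x).differentiableAt.differentiableWithinAt) fun x hx => ?_
  rw [interior_Icc] at hx
  rw [(hderiv x).deriv]
  exact derivSum_nonpos F N (fun k hk => succ_mul_le_of_crossAnti F N k hk (hmono k hk))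
    hx.1.le hx.2.le

/-- **Stub A (provable, elementary): binomial mixtures of monotone profiles.** For a
non-negative sequence `N` write `φ̄_k = N_k / C(F,k)`; then
`Σ_{k ≤ F} s^k (1-s)^{F-k} N_k = E_{Bin(F,s)} φ̄_K`. (i) If `φ̄` is non-decreasing on `0…F`
(cross-multiplied: `N_k C(F,k+1) ≤ N_{k+1} C(F,k)`), the mixture is at least `φ̄_0 = N_0` for every
`s ∈ [0,1]` (the binomial weights sum to `1`, `add_pow`). (ii) If `φ̄` is non-increasing, the
mixture is a non-increasing function of `s ∈ [0,1]` (stochastic monotonicity of the binomial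
family, via the Bernstein-type derivative
`Σ_{k<F} s^k (1-s)^{F-1-k} ((k+1) N_{k+1} - (F-k) N_k) ≤ 0` and `antitoneOn_of_deriv_nonpos`).
The sign hypothesis on `N` is not used. -/
theorem stub_binomial :
    (∀ (F : ℕ) (N : ℕ → ℝ), (∀ k, 0 ≤ N k) →
      (∀ k, k + 1 ≤ F → N k * (F.choose (k + 1) : ℝ) ≤ N (k + 1) * (F.choose k : ℝ)) →
      ∀ s : ℝ, 0 ≤ s → s ≤ 1 →
        N 0 ≤ ∑ k ∈ Finset.range (F + 1), s ^ k * (1 - s) ^ (F - k) * N k) ∧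
    (∀ (F : ℕ) (N : ℕ → ℝ), (∀ k, 0 ≤ N k) →
      (∀ k, k + 1 ≤ F → N (k + 1) * (F.choose k : ℝ) ≤ N k * (F.choose (k + 1) : ℝ)) →
      AntitoneOn (fun s : ℝ => ∑ k ∈ Finset.range (F + 1), s ^ k * (1 - s) ^ (F - k) * N k)
        (Set.Icc 0 1)) :=
  ⟨fun F N _ hmono _ hs0 hs1 => le_binomialMixture F N hmono hs0 hs1,
    fun F N _ hmono => binomialMixture_antitoneOn F N hmono⟩

end Summit.CriticalPhenomena.CardyFormulaZ2.Cruxes.UniformBoxCrossing.Microcanonical
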